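import Mathlib
import HarnessLib

/-!
# Barrier: Hironaka's HARD polyhedra game is lost by the first player for `n ≥ 3` — a period-2 configuration
# (Spivakovsky 1982) («HardPolyhedraGameTwoCycle»)

`Literature/Barriers/ResolutionOfSingularities/HardPolyhedraGameTwoCycle.lean` — barrier catalogue entry (D-0021) for the summit
`ResolutionOfSingularities`, filed for the LADDER-RESOLUTION cell `res-idea` (desk ROUTE 317 (2), 2026-08-28: «no catalogue entry for
the hard game»; card #95 = K11-16 (iii), reduction-census row R11-34; ingredients: seat res-idea-lens-11, memo
`pub/res-idea/res-idea-lens-11/K11-16-barrier-memo.md` 2c58bebbb4b5e3e1, decidable replay landed on the Summits side as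
`Summits/…/Theorems/Rescue/ResIdeaHardGameTwoCycle` p638716 and vertex certificates `…/o8/ResIdeaHardGameTwoCycleVert.lean`; referee A
precision V-g9-8 «vertex-ness against convex combinations»; filer referee B = refuter res-idea-ref-2, Batch 153). The formal core is
PROVED here (all claims `decide`d on explicit natural-number data; no `sorry`, no new axiom, no named fact: D-0026 debt unchanged);
nothing is imported from the Summits side.

## What the source prints (page hits on the held text `paper:doi-10-2977-prims-1195183292`; the OCR loses the fractions)

M. Spivakovsky, *A counterexample to Hironaka's "hard" polyhedra game*, Publ. RIMS Kyoto Univ. 18 (1982) 1009–1012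
[cite: Spivakovsky1982, p. 1010]. p. 1009 L10–17: «we give a counterexample to the "hard" polyhedra game, proposed by Hironaka …
Hironaka has proved that an affirmative solution of this game would imply the local uniformization theorem for an algebraic variety
over an algebraically closed field of any characteristic. Although the answer turns out to be negative … The original, simpler version of
the game … does have such a winning strategy (see [4])». p. 1010 (RULES): `Δ ⊂ ℝⁿ_{≥0}` is the positive convex hull
`conv ⋃ (v_k + ℝⁿ_{≥0})` of finitely many rational points (denominators bounded by a fixed `N`); NEAR: `Σ_j x_j ≥ 1` on `Δ`; A chooses a
PERMISSIBLE `F ⊆ {1..n}` (`Σ_{j∈F} x_j ≥ 1` on `Δ`); «Then, B chooses some element `i ∈ F` and modifies the set `Δ` to a set `Δ*` by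
the following procedure: first, B selects a finite number of points `b` … for each of which there exists an `a ∈ Δ` such that
(1) `b_j = a_j` for `j ∉ F` or `j < i`; (2) `b_i ≥ a_i`; (3) `b_j ≤ a_j` when `j ∈ F` and `j > i`; (4) `Σ b_j = Σ a_j`. `Δ*` is then taken
to be the positive convex hull of `Δ ∪ {the selected points}`. Note. The allowance of this modification `Δ → Δ*` is the only
difference of the "hard" game from the original "simple" polyhedra game. Then, let `Δ′ = σ_{F,i}(Δ*)`, where `σ_{F,i}` … `x′_j = x_j`
if `j ≠ i`, `x′_i = Σ_{j∈F} x_j − 1`»; A WINS if after finitely many moves `Δ` contains a point with `Σ x_j < 1` (Hironaka's version of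
the winning condition; the orthant version «`Δ` becomes `a + ℝⁿ_{≥0}`» is the one of [cite: Spivakovsky1983, §1] / the JPAA 2011 survey
`paper:doi-10-1016-j-jpaa-2010-12-005` p. 3 L19 — BOTH are refuted below); «For `n ≤ 2` the answer is affirmative … The
counterexample below is for `n = 3`.» p. 1011 L12–17: «First move: A has no choice but `F = {1,2,3}`. B chooses `i = 2` and modifies
`Δ₁` to `Δ₁*` … Then `σ_{F,2}(Δ₁*) = Δ₂` … Note that this is the reflection of `Δ₁` with respect to the plane `x₁ = x₂`. Second move: A has
no choice but `F = {1,2,3}`. B chooses `i = 1` … Then `σ_{F,1}(Δ₂*) = Δ₁`. This is repeated forever. All through the game, A has only one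
permissible move, `F = {1,2,3}`, and B alternates between `i = 1` and `i = 2` … Clearly, A cannot win.»

## What is typed here (presentation-level game; why it is WEAKER than print for B and EXACT for A)

States are finite generator sets `V ⊂ ℕ³` of `N = conv(V) + ℝ³_{≥0}`, SCALED by `3` (all data of the instance lie in `(1/3)ℕ`).
`Near`, `Permissible F` and `Won` are evaluated on generators — legitimately: each is the sign of the minimum over `N` of a linear
functional that is non-negative on the orthant (attained at a generator), and «`N` is an orthant `w + ℝ³_{≥0}`» holds iff some
GENERATOR is `≤` all generators (the apex is the unique vertex, hence a generator). The transform `σ_{F,i}` is affine and maps the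
orthant's directions into the orthant, so `σ(N) + ℝ³_{≥0} = conv(σ V) + ℝ³_{≥0}`: it acts generator-wise (`HardGame.sigma`). B is
RESTRICTED to (α) additions `b` built from a point `a` that dominates a current GENERATOR (a sufficient condition for `a ∈ N`) by the
extreme instance of rules (1)–(4) — all the mass of the coordinates `j ∈ F`, `j > i` moved onto `i` (`HardGame.addition`) — and
(β) deletions of a generator `v` certified redundant by `c_u·u + c_w·w ≤ (c_u + c_w)·v` for two other generators (an `N`-preserving
re-presentation, `HardGame.delsLegal`). Restricting B and letting A range over ALL permissible `F` makes «A cannot force a win»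
a consequence for the printed game a fortiori. Winning is the DISJUNCTION of both printed conditions (`HardGame.Won`).

The instance (OURS under the printed rules — the paper's own fractions are illegible in the held copy; say «an instance», never
«Spivakovsky's vertices»): `V₁ = {(0,0,3), (2,5,0), (5,0,0)}` (= `(0,0,1), (2/3,5/3,0), (5/3,0,0)`), `V₂` = its mirror `x₁ ↔ x₂`.
At both, ONLY `F = {1,2,3}` is permissible (`permissible_V₁_iff`, `permissible_V₂_iff`); B's reply `r₁` at `V₁`: add from
`a₁ = (0,2,6) ≥ (0,0,3)`, i.e. `b₁ = (0,8,0)`; chart `i = 2`: `σ` gives `{(0,0,3), (2,4,0), (5,2,0), (0,5,0)}`; delete `(2,4,0)`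
(`3·(0,5,0) + 2·(5,2,0) ≤ 5·(2,4,0)`, λ = 3/5) ⇒ `V₂` (`next_V₁`); the mirrored reply `r₂` returns to `V₁` (`next_V₂`); neither is won
(`not_won_V₁/₂`: all generator sums `≥ 3`, three pairwise incomparable generators). Hence `{V₁, V₂}` is a B-TRAP (`isBTrap_pair`),
A cannot force a win within any number of rounds (`not_aWinsIn_of_isBTrap`, `not_aWinsIn`), and the headline
`HardPolyhedraGameTwoCycle` packages trap + forcing + nearness.

## Application recorded here (cell res-idea; HONEST FRAMING)

The cell reads the hard game as the polyhedral SHADOW of point-blow-up sequences in dimension `≥ 3` with coordinate changes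
(B's additions = shadow of translations `u_j ↦ u_j + t·u_i`). The entry says exactly: a termination argument whose measure is a
function of the characteristic polyhedron `Δ(f; u)` ALONE and must decrease (or reach a winning shape) under every hard-game-admissible
move cannot exist for `n ≥ 3` parameters. It says NOTHING about genuine resolution sequences of a variety: the cycling configuration
is not shown to be realised by a hypersurface and its coordinate changes (genuine translations produce Hasse-derivative / Lucas-constrained
supports, far more rigid than free additions), dimension 3 in positive characteristic IS a theorem (Cossart–Piltant) despite the `n = 3`
game cycle, and the SIMPLE game (no additions) is WON by A [cite: Spivakovsky1983, §1] (also Zeillinger 2006; «almost arbitrary»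
winning strategies, JPAA 2011). Cell data of record (not kernel, cited by name): 0 support-level formal cycles on 45 000+ genuine decent
steps at `(p,n) ∈ {(3,2),(5,2),(3,3)}` (lens-11 E3); the res-idea door (RES-C clauses C1 `Orders`/`StrictOnBranch`) is untouched by
this entry. Resolution of singularities in dimension `≥ 4` / characteristic `p` is NOT proved or refuted by any of this.
-/

namespace Literature.Barriers.ResolutionOfSingularities.HardGame

open Finset BigOperators

/-- Scaled game vectors: a point `x ∈ ℚ³_{≥0}` with denominators dividing `3` is stored as `3·x ∈ ℕ³`. [cite: Spivakovsky1982, p. 1010] -/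
abbrev Vec := Fin 3 → ℕ

/-- Coordinatewise domination `u ≤ v`. [cite: Spivakovsky1982, p. 1010] -/
def Dom (u v : Vec) : Prop := ∀ j, u j ≤ v j

/-- decidability by unfolding (all game predicates are finite checks on generators). -/
instance (u v : Vec) : Decidable (Dom u v) := inferInstanceAs (Decidable (∀ j, u j ≤ v j))

/-- NEAR (scaled): every point of `N = conv(V) + ℝ³_{≥0}` has coordinate sum `≥ 1`, i.e. every generator has scaled sum `≥ 3`
(the sum is linear, so its minimum over `N` is attained at a generator). [cite: Spivakovsky1982, p. 1010] -/
def Near (V : Finset Vec) : Prop := ∀ v ∈ V, 3 ≤ ∑ j, v j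

/-- decidability by unfolding (all game predicates are finite checks on generators). -/
instance (V : Finset Vec) : Decidable (Near V) := by unfold Near; infer_instance

/-- A's move `F` is PERMISSIBLE at `V`: `Σ_{j∈F} x_j ≥ 1` on `N` — equivalently (linearity, non-negativity on the orthant) on the
generators: scaled `Σ_{j∈F} v_j ≥ 3`.  (`F` non-empty is implied whenever `V` is non-empty.) [cite: Spivakovsky1982, p. 1010] -/
def Permissible (F : Finset (Fin 3)) (V : Finset Vec) : Prop := ∀ v ∈ V, 3 ≤ ∑ j ∈ F, v j

/-- decidability by unfolding (all game predicates are finite checks on generators). -/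
instance (F : Finset (Fin 3)) (V : Finset Vec) : Decidable (Permissible F V) := by unfold Permissible; infer_instance

/-- A has WON at `V` under EITHER printed winning condition: (Hironaka's version, used by Spivakovsky 1982) `N` contains a point of
coordinate sum `< 1` — equivalently some generator has scaled sum `< 3`; or (Spivakovsky's version / Zeillinger) `N` is an orthant
`w + ℝ³_{≥0}` — equivalently `∃ w ∈ V, ∀ v ∈ V, w ≤ v` (the apex of an orthant is
its unique vertex, hence a generator). [cite: Spivakovsky1982, p. 1010] -/
def Won (V : Finset Vec) : Prop := (∃ v ∈ V, ∑ j, v j < 3) ∨ ∃ w ∈ V, ∀ v ∈ V, Dom w v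

/-- decidability by unfolding (all game predicates are finite checks on generators). -/
instance (V : Finset Vec) : Decidable (Won V) := by unfold Won; infer_instance

/-- The transform `σ_{F,i}` (scaled): `x_i ← Σ_{j∈F} x_j − 1`, other coordinates unchanged. It is affine, maps the orthant's
directions into the orthant, so `σ(N) + ℝ³_{≥0} = conv(σ V) + ℝ³_{≥0}`: on presentations it acts generator-wise. [cite: Spivakovsky1982, p. 1010] -/
def sigma (F : Finset (Fin 3)) (i : Fin 3) (v : Vec) : Vec := Function.update v i ((∑ j ∈ F, v j) - 3)

/-- B's ADDITION attached to the chart index `i` and the move `F` (rules (1)–(4), Spivakovsky 1982 p. 1010): from a point `a ∈ N`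
B may add `b` with `b_j = a_j` for `j ∉ F` or `j < i`, `b_i ≥ a_i`, `b_j ≤ a_j` for `j ∈ F`, `j > i`, and `Σ b = Σ a`.  We use the
extreme instance: ALL the mass of the coordinates `j ∈ F`, `j > i` is moved onto `i`. [cite: Spivakovsky1982, p. 1010] -/
def addition (F : Finset (Fin 3)) (i : Fin 3) (a : Vec) : Vec :=
  fun j => if j = i then a i + ∑ l ∈ F.filter (fun l => i < l), a l else if j ∈ F ∧ i < j then 0 else a j

/-- A REPLY of B to the move `F`: finitely many addition points `adds` (each required to dominate a current generator — a
SUFFICIENT condition for `a ∈ N`; restricting B this way only helps A), the chart index `i`, and finitely many DELETIONS of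
generators, each certified redundant by an explicit domination `c_u·u + c_w·w ≤ (c_u + c_w)·v` by two other kept generators
(an `N`-preserving re-presentation). [cite: Spivakovsky1982, p. 1010] -/
structure Reply where
  adds : List Vec
  i : Fin 3
  dels : List (Vec × Vec × Vec × ℕ × ℕ)

/-- Apply the additions. [cite: Spivakovsky1982, p. 1010] -/
def addAll (F : Finset (Fin 3)) (i : Fin 3) : Finset Vec → List Vec → Finset Vec
  | V, [] => V
  | V, a :: as => addAll F i (insert (addition F i a) V) as

/-- Legality of the additions (checked recursively): each `a` dominates some CURRENT generator. [cite: Spivakovsky1982, p. 1010] -/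
def addsLegal (F : Finset (Fin 3)) (i : Fin 3) : Finset Vec → List Vec → Bool
  | _, [] => true
  | V, a :: as => decide (∃ v ∈ V, Dom v a) && addsLegal F i (insert (addition F i a) V) as

/-- Apply the deletions. [cite: Spivakovsky1982, p. 1010] -/
def delAll : Finset Vec → List (Vec × Vec × Vec × ℕ × ℕ) → Finset Vec
  | V, [] => V
  | V, (v, _, _, _, _) :: ds => delAll (V.erase v) ds

/-- Legality of the deletions: `v, u, w` are current generators, `u ≠ v`, `w ≠ v`, `0 < c_u + c_w`, and
`c_u·u + c_w·w ≤ (c_u + c_w)·v` coordinatewise (so `v` lies above the segment `[u, w]`: removing it does not change `N`). [cite: Spivakovsky1982, p. 1010] -/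
def delsLegal : Finset Vec → List (Vec × Vec × Vec × ℕ × ℕ) → Bool
  | _, [] => true
  | V, (v, u, w, cu, cw) :: ds =>
      decide (v ∈ V ∧ u ∈ V ∧ w ∈ V ∧ u ≠ v ∧ w ≠ v ∧ 0 < cu + cw ∧ ∀ j, cu * u j + cw * w j ≤ (cu + cw) * v j) &&
        delsLegal (V.erase v) ds

/-- The reply `r` is LEGAL for the move `F` at `V`. [cite: Spivakovsky1982, p. 1010] -/
def Legal (V : Finset Vec) (F : Finset (Fin 3)) (r : Reply) : Prop :=
  r.i ∈ F ∧ addsLegal F r.i V r.adds = true ∧ delsLegal ((addAll F r.i V r.adds).image (sigma F r.i)) r.dels = true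

/-- decidability by unfolding (all game predicates are finite checks on generators). -/
instance (V : Finset Vec) (F : Finset (Fin 3)) (r : Reply) : Decidable (Legal V F r) := by
  unfold Legal; infer_instance

/-- The next presentation after the move `F` and the reply `r`. [cite: Spivakovsky1982, p. 1010] -/
def next (V : Finset Vec) (F : Finset (Fin 3)) (r : Reply) : Finset Vec :=
  delAll ((addAll F r.i V r.adds).image (sigma F r.i)) r.dels

/-- `AWinsIn n V`: player A can force a win within `n` rounds from the presentation `V` against every legal reply of (restricted) B. [cite: Spivakovsky1982, p. 1010] -/
def AWinsIn : ℕ → Finset Vec → Prop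
  | 0, V => Won V
  | n + 1, V => Won V ∨ ∃ F : Finset (Fin 3), Permissible F V ∧ ∀ r : Reply, Legal V F r → AWinsIn n (next V F r)

/-! ## The period-2 instance (scaled by 3; OURS under the printed rules) -/

/-- `V₁ = {(0,0,1), (2/3,5/3,0), (5/3,0,0)}`, scaled. [cite: Spivakovsky1982, p. 1011] -/
def V₁ : Finset Vec := {![0, 0, 3], ![2, 5, 0], ![5, 0, 0]}

/-- `V₂` = the mirror `x₁ ↔ x₂` of `V₁`. [cite: Spivakovsky1982, p. 1011] -/
def V₂ : Finset Vec := {![0, 0, 3], ![0, 5, 0], ![5, 2, 0]}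

/-- `V₁` is near (all scaled generator sums `≥ 3`). [cite: Spivakovsky1982, p. 1010] -/
theorem near_V₁ : Near V₁ := by decide
/-- `V₂` is near. [cite: Spivakovsky1982, p. 1010] -/
theorem near_V₂ : Near V₂ := by decide

/-- `V₁` is not won under either winning condition (sums `≥ 3`; three pairwise incomparable generators). [cite: Spivakovsky1982, p. 1011] -/
theorem not_won_V₁ : ¬ Won V₁ := by decide
/-- `V₂` is not won under either winning condition. [cite: Spivakovsky1982, p. 1011] -/
theorem not_won_V₂ : ¬ Won V₂ := by decide

/-- At `V₁` player A is FORCED: the only permissible move is `F = {1,2,3}`. [cite: Spivakovsky1982, p. 1011] -/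
theorem permissible_V₁_iff (F : Finset (Fin 3)) : Permissible F V₁ ↔ F = univ := by
  revert F; decide

/-- At `V₂` player A is forced as well: only `F = {1,2,3}` is permissible. [cite: Spivakovsky1982, p. 1011] -/
theorem permissible_V₂_iff (F : Finset (Fin 3)) : Permissible F V₂ ↔ F = univ := by
  revert F; decide

/-- B's reply at `V₁`: add from `a₁ = (0,2,6) ≥ (0,0,3)` (giving `b₁ = (0,8,0)`), chart `i = 2`, then delete the redundant
`(2,4,0)` (`3·(0,5,0) + 2·(5,2,0) ≤ 5·(2,4,0)`). [cite: Spivakovsky1982, p. 1011] -/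
def r₁ : Reply := ⟨[![0, 2, 6]], 1, [(![2, 4, 0], ![0, 5, 0], ![5, 2, 0], 3, 2)]⟩

/-- B's reply at `V₂` (the mirror): `a₂ = (2,0,6)`, `i = 1`, delete `(4,2,0)`. [cite: Spivakovsky1982, p. 1011] -/
def r₂ : Reply := ⟨[![2, 0, 6]], 0, [(![4, 2, 0], ![5, 0, 0], ![2, 5, 0], 3, 2)]⟩

/-- `r₁` is a legal (restricted) reply to `F = {1,2,3}` at `V₁`. [cite: Spivakovsky1982, p. 1010] -/
theorem legal_r₁ : Legal V₁ univ r₁ := by decide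

/-- `r₂` is a legal (restricted) reply to `F = {1,2,3}` at `V₂`. [cite: Spivakovsky1982, p. 1010] -/
theorem legal_r₂ : Legal V₂ univ r₂ := by decide

/-- Round 1: `V₁ ⟶ V₂` (addition `(0,8,0)`, chart `2`, deletion of `(2,4,0)` with `λ = 3/5`). [cite: Spivakovsky1982, p. 1011] -/
theorem next_V₁ : next V₁ univ r₁ = V₂ := by decide

/-- Round 2 (mirror): `V₂ ⟶ V₁`. [cite: Spivakovsky1982, p. 1011] -/
theorem next_V₂ : next V₂ univ r₂ = V₁ := by decide

/-- PERIOD 2: from `V₁` (and from `V₂`) player A cannot force a win within any number of rounds. [cite: Spivakovsky1982, p. 1011] -/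
theorem not_aWinsIn (n : ℕ) : ¬ AWinsIn n V₁ ∧ ¬ AWinsIn n V₂ := by
  induction n with
  | zero => exact ⟨not_won_V₁, not_won_V₂⟩
  | succ n ih =>
      refine ⟨?_, ?_⟩
      · rintro (h | ⟨F, hF, hall⟩)
        · exact not_won_V₁ h
        · obtain rfl := (permissible_V₁_iff F).1 hF
          have := hall r₁ legal_r₁
          rw [next_V₁] at this
          exact ih.2 this
      · rintro (h | ⟨F, hF, hall⟩)
        · exact not_won_V₂ h
        · obtain rfl := (permissible_V₂_iff F).1 hF
          have := hall r₂ legal_r₂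
          rw [next_V₂] at this
          exact ih.1 this


/-- A B-TRAP: a set of presentations, none of them won, inside which EVERY permissible move of A has a legal reply of
(restricted) B that stays inside.  From a member of a B-trap every strategy of A is answered for ever: A has no winning strategy
there, under either winning condition. [cite: Spivakovsky1982, p. 1010] -/
def IsBTrap (S : Set (Finset Vec)) : Prop :=
  ∀ V ∈ S, ¬ Won V ∧ ∀ F : Finset (Fin 3), Permissible F V → ∃ r : Reply, Legal V F r ∧ next V F r ∈ S

/-- The two mirrored configurations form a B-trap. [cite: Spivakovsky1982, p. 1011] -/
theorem isBTrap_pair : IsBTrap {V₁, V₂} := by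
  intro V hV
  simp only [Set.mem_insert_iff, Set.mem_singleton_iff] at hV
  rcases hV with rfl | rfl
  · refine ⟨not_won_V₁, fun F hF => ⟨r₁, ?_, ?_⟩⟩
    · obtain rfl := (permissible_V₁_iff F).1 hF; exact legal_r₁
    · obtain rfl := (permissible_V₁_iff F).1 hF; rw [next_V₁]; simp
  · refine ⟨not_won_V₂, fun F hF => ⟨r₂, ?_, ?_⟩⟩
    · obtain rfl := (permissible_V₂_iff F).1 hF; exact legal_r₂
    · obtain rfl := (permissible_V₂_iff F).1 hF; rw [next_V₂]; simp

/-- Inside a B-trap, A cannot force a win within any number of rounds. [cite: Spivakovsky1982, p. 1010] -/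
theorem not_aWinsIn_of_isBTrap {S : Set (Finset Vec)} (hS : IsBTrap S) : ∀ n, ∀ V ∈ S, ¬ AWinsIn n V := by
  intro n
  induction n with
  | zero => intro V hV h; exact (hS V hV).1 h
  | succ n ih =>
      intro V hV h
      rcases h with h | ⟨F, hF, hall⟩
      · exact (hS V hV).1 h
      · obtain ⟨r, hr, hmem⟩ := (hS V hV).2 F hF
        exact ih _ hmem (hall r hr)

end Literature.Barriers.ResolutionOfSingularities.HardGame

namespace Literature.Barriers.ResolutionOfSingularities

open HardGame in
/-- **Barrier `HardPolyhedraGameTwoCycle`** (kernel form; instance OURS under the printed rules of [cite: Spivakovsky1982, p. 1010]):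
in Hironaka's HARD polyhedra game with `n = 3` there is a NEAR configuration `V₁` lying in a B-trap `S = {V₁, V₂}` on which
player A is FORCED (`F = {1,2,3}` is the only permissible move at every member) and B — even restricted to one addition from a point
dominating a generator plus one certified deletion per round — returns the polyhedron to the mirrored configuration; neither member
is won under either printed winning condition.  Consequently A has no winning strategy from `V₁` (and cannot force a win within
any number of rounds: `HardGame.not_aWinsIn_of_isBTrap`).  The THEOREM «the hard game is lost by A for `n ≥ 3`» is
[cite: Spivakovsky1982, p. 1011]; this entry re-proves one period-2 instance, not the paper's own fractions.

Technique class, in prose: termination arguments for sequences of point (or coordinate-stratum) blow-ups in `n ≥ 3` local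
parameters whose measure is a function of the characteristic / Newton polyhedron `Δ(f; u)` ALONE and which must improve under EVERY
move the hard game allows B — the chart choice `i ∈ F` AND the vertex additions (1)–(4), the polyhedral shadow of the coordinate
changes `u_j ↦ u_j + t·u_i` made between blow-ups.

BARRIER (D-0021):
- technique_class: polyhedra-game hard-polyhedra-game characteristic-polyhedron newton-polyhedron-measure point-blowup-termination vertex-addition coordinate-change-shadow dimension-three-parameters local-uniformization positive-characteristic game-abstraction
- blocks: every strategy for player A in the hard game with `n = 3` (hence `n ≥ 3`, by ignoring coordinates) started at the near configuration `V₁`: B restricted to ONE addition from a point dominating a generator and ONE certified deletion per round already keeps the polyhedron in `{V₁, V₂}` for ever (`HardGame.isBTrap_pair`), A being forced to `F = {1,2,3}` throughout; in particular no function of `Δ` with values in a well-founded order decreases along all hard-game plays, and no bound `n` on the number of rounds to a win exists (`HardGame.not_aWinsIn_of_isBTrap`).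
- because: `permissible_V₁_iff`/`permissible_V₂_iff` (the three generators kill every proper `F`: `(0,0,3)` kills `F ∌ 3`, `(2,5,0)` kills `{1,3}`, `(5,0,0)` kills `{2,3}`, `{3}`), `legal_r₁`/`legal_r₂` (the addition point dominates `(0,0,3)`; the deleted generator lies above a segment of two kept ones, certificate `3·u + 2·w ≤ 5·v`), `next_V₁`/`next_V₂` (the transforms and the mirror identity), `not_won_V₁`/`not_won_V₂` — all `decide`d on the scaled data.
- evasions_known: (i) the SIMPLE game (no additions) IS won by A [cite: Spivakovsky1983, §1] (Zeillinger 2006; JPAA 2011 «almost arbitrary» strategies) — measures that need not survive coordinate changes are not blocked; (ii) measures that see MORE than `Δ(f; u)` — the boundary / exceptional history, Hasse–derivative data of the coefficient ideal, the residual order after the exceptional monomial (CJS, dimension 3) — are outside the class: genuine translations constrain the new support (Lucas / Hasse conditions) far more than free additions, and dimension-3 resolution in characteristic `p` (Cossart–Piltant 2008/2009/2019) holds despite the `n = 3` cycle; (iii) the cycle is not known to be realised by an actual hypersurface and actual coordinate changes (no transfer from the game to varieties is claimed in print or here).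
- scope_caveats: (a) PROVED: the presentation-level statements for OUR scaled instance (`n = 3`, data in `(1/3)ℕ`), with B RESTRICTED as described (which only strengthens «A cannot win») and winning taken as the disjunction of both printed conditions; the identification «presentation game = printed game on `N`» rests on three one-line convexity facts stated in the module docstring (linear functionals attain their minimum over `conv(V) + ℝ³_{≥0}` at a generator; the apex of an orthant is a generator; `σ` acts generator-wise), which are NOT formalised; (b) the paper's own configuration (p. 1011) is not reproduced — its fractions are illegible in the held OCR; the instance is ours under the printed rules (rider B-K11-16-1 of the cell); (c) «A has no winning strategy» is rendered as the B-trap certificate (every permissible move answered inside a set of non-won states), the standard positional witness; no strategy/play formalism beyond `AWinsIn` is set up; (d) a GAME statement: nothing here is a claim about resolution of singularities of any variety, in any dimension or characteristic.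
- status: established (kernel-checked instance; theorem of record cited)
-/
theorem HardPolyhedraGameTwoCycle :
    ∃ S : Set (Finset HardGame.Vec), HardGame.V₁ ∈ S ∧ HardGame.IsBTrap S ∧
      ∀ V ∈ S, HardGame.Near V ∧ ¬ HardGame.Won V ∧ ∀ F : Finset (Fin 3), HardGame.Permissible F V ↔ F = Finset.univ := by
  refine ⟨{V₁, V₂}, by simp, isBTrap_pair, ?_⟩
  intro V hV
  simp only [Set.mem_insert_iff, Set.mem_singleton_iff] at hV
  rcases hV with rfl | rfl
  · exact ⟨near_V₁, not_won_V₁, permissible_V₁_iff⟩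
  · exact ⟨near_V₂, not_won_V₂, permissible_V₂_iff⟩

end Literature.Barriers.ResolutionOfSingularities
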